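import Summits.CriticalPhenomena.PercolationContinuityZ3.Theorems.PercNearOneGluingAdditiveGluingKnLemma2General
import Summits.CriticalPhenomena.PercolationContinuityZ3.Theorems.PercNearOneGluingAdditiveGluingDKernelThree
import HarnessLib

/-! # Crux `PercNearOneGluing.AdditiveGluing` (stmt-CriticalPhenomena-4576) — Kozma–Nitzan's Theorem-2 exchange for ANY NUMBER OF
# RELAYS at an arbitrary designation, and its block form (seat (d) gen 1, after residual member #1)

Support file (`--supports stmt-CriticalPhenomena-4576`); no definitions, no named facts.

KN prove Theorem 2 (pre-FKG (3) for `|A| = 3` under `m_j ≤ m_{A∖j}`) by pairing the expansion of `P(o↔b, o↔A)` along `C(o) ∩ A`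
with the expansion of `P(o↔A, a₃↔b)` along `C(b) ∩ A`, six set-BHK steps and Lemma 2.  Their Lemmas 1–2 are stated for any number
of points, and the pairing is by COMPLEMENTARY relay sets, so the argument runs verbatim for `k` relays `R ∋ d` (designation `d`,
observer `o`, target `b`):
  `X := μ(o↔R, o↔b, d↮b) − μ(o↔R, d↔b, o↮b) = Σ_{T ⊆ R∖d} [μ({T↔o} ∩ E_T) − μ({T↔o} ∩ E_{R∖T})]`,
  `E_T := {b ↔ every a ∈ T} ∩ {b ↮ every a ∈ R∖T}` (`knK_expand_left/right`), and per `T`, with `D_T := {T ↮ R∖T}`,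
  `φ_T := μ(D_T ∩ {T↔o}) / μ(D_T)`, `m_T := μ(E_T)`:  `μ({T↔o} ∩ E_T) − μ({T↔o} ∩ E_{R∖T}) ≥ φ_T (m_T − m_{R∖T})`
  (BHK Thms 1.3/1.4 for set sources, `knThm2_bhkOne/Two`), and `φ_T ≥ Σ_{i∈T} φ_{i}` (Lemma 2, `knK_lemma2`, when all relays are
  separable with positive probability).  Hence (`knThmK_designated`)
  `X ≥ Σ_T c_T (m_T − m_{R∖T})`,  `c_T = Σ_{i∈T} φ_i` if `m_T ≥ m_{R∖T}` (or `|T| = 1`), else `φ_T`,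
and `μ((o↔R) ∩ (d↔b)) ≤ μ((o↔R) ∩ (o↔b))` whenever this CERTIFICATE is `≥ 0`; for three relays it is `knThm2_designated`.
Block form `dKernel_of_knThmK`: the designated-pocket kernel `μ_{u/S}((S↔A) ∩ (a₀↔b)) ≤ μ_{u/S}(S↔b)` for any number of relays.
Census (lab/dcert.py KNK): the certificate is `+1.7e−3` on the first member found of the residual class of `additiveGluing_of_dcert3`
(kit j036969: four relays, where Theorem 2 itself is unavailable), and `D − LB_k ≥ 0` held in every sampled instance and designation.
[cite: KozmaNitzan2024, Theorem 2 (§3.1, pp. 8–9), Lemmas 1–2 pp. 5–6; VandenbergHaggstromKahn2006, Thms. 1.3–1.4]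
-/

namespace Summit.CriticalPhenomena.PercolationContinuityZ3.Theorems

open MeasureTheory Set Literature.Probability.LatticeModels Literature.Probability.Percolation
open scoped BigOperators

noncomputable section
open Classical

section KnThmK

variable {n : ℕ}

/-- `E_T = D_T ∩ {every relay of T is joined to b}` for nonempty `T` (`D_T = {T ↮ R∖T}`). [folklore] -/
theorem knK_E_eq (R T : Finset (Fin n)) (b : Fin n) (hT : T.Nonempty) :
    ({ω : BondConfig (Fin n) | ∀ s ∈ T, ∀ x ∈ (↑(R \ T) : Set (Fin n)), ¬ (openGraph ω).Reachable s x} ∩ ⋂ s ∈ T, openConn s b) =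
      ((⋂ a ∈ T, openConn a b) ∩ ⋂ a ∈ R \ T, (openConn a b)ᶜ : Set (BondConfig (Fin n))) := by
  obtain ⟨s₀, hs₀⟩ := hT
  ext ω
  simp only [Set.mem_inter_iff, Set.mem_setOf_eq, Set.mem_iInter, Set.mem_compl_iff, Finset.coe_sdiff, Set.mem_sdiff, Finset.mem_coe,
    Finset.mem_sdiff]
  constructor
  · rintro ⟨hD, hTb⟩
    exact ⟨hTb, fun a ha hab => hD s₀ hs₀ a ⟨ha.1, ha.2⟩ (blockGrowth_openConn_trans (hTb s₀ hs₀) (blockGrowth_openConn_symm hab))⟩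
  · rintro ⟨hTb, hN⟩
    exact ⟨fun s hs x hx hsx => hN x ⟨hx.1, hx.2⟩ (blockGrowth_openConn_trans (blockGrowth_openConn_symm hsx) (hTb s hs)), hTb⟩

/-- `E'_T := E_{R∖T} = D_T ∩ {every relay of R∖T is joined to b}` for `T ⊆ R` with `R∖T` nonempty. [folklore] -/
theorem knK_E'_eq (R T : Finset (Fin n)) (b : Fin n) (hT : (R \ T).Nonempty) :
    ({ω : BondConfig (Fin n) | ∀ s ∈ T, ∀ x ∈ R \ T, ¬ (openGraph ω).Reachable s x} ∩ ⋂ s ∈ R \ T, openConn s b) =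
      ((⋂ a ∈ R \ T, openConn a b) ∩ ⋂ a ∈ T, (openConn a b)ᶜ : Set (BondConfig (Fin n))) := by
  obtain ⟨x₀, hx₀⟩ := hT
  ext ω
  simp only [Set.mem_inter_iff, Set.mem_setOf_eq, Set.mem_iInter, Set.mem_compl_iff, Finset.mem_sdiff]
  rw [Finset.mem_sdiff] at hx₀
  constructor
  · rintro ⟨hD, hUb⟩
    exact ⟨hUb, fun a ha hab => hD a ha x₀ ⟨hx₀.1, hx₀.2⟩
      (blockGrowth_openConn_trans hab (blockGrowth_openConn_symm (hUb x₀ hx₀)))⟩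
  · rintro ⟨hUb, hN⟩
    refine ⟨fun s hs x hx hsx => hN s hs (blockGrowth_openConn_trans hsx (hUb x hx)), hUb⟩

/-- **The set-BHK pair bound for one relay pattern `T`** (two of KN's "six applications"), upgraded by Lemma 2 when the pattern
difference is nonnegative:  `c_T · (m_T − m_{R∖T}) ≤ μ({T↔o} ∩ E_T) − μ({T↔o} ∩ E_{R∖T})`, with `c_T = Σ_{i∈T} φ_i` if
`m_{R∖T} ≤ m_T` and `c_T = φ_T` otherwise.  [cite: KozmaNitzan2024, Theorem 2 proof p. 9, Lemmas 1–2 pp. 5–6] -/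
theorem knK_perT (w : Sym2 (Fin n) → unitInterval) (o b : Fin n) (R T : Finset (Fin n)) (hTR : T ⊆ R) (hT : T.Nonempty)
    (hT' : (R \ T).Nonempty)
    (hM : 0 < (prodBernoulli w).real {ω : BondConfig (Fin n) | ∀ k ∈ R, ∀ j ∈ R, k ≠ j → ¬ (openGraph ω).Reachable k j}) :
    (if (prodBernoulli w).real ((⋂ a ∈ R \ T, openConn a b) ∩ ⋂ a ∈ T, (openConn a b)ᶜ : Set (BondConfig (Fin n)))
          ≤ (prodBernoulli w).real ((⋂ a ∈ T, openConn a b) ∩ ⋂ a ∈ R \ T, (openConn a b)ᶜ : Set (BondConfig (Fin n)))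
        then ∑ i ∈ T, (prodBernoulli w).real ({ω : BondConfig (Fin n) | ∀ x ∈ R.erase i, ¬ (openGraph ω).Reachable i x} ∩ openConn i o) /
          (prodBernoulli w).real {ω : BondConfig (Fin n) | ∀ x ∈ R.erase i, ¬ (openGraph ω).Reachable i x}
        else (prodBernoulli w).real ({ω : BondConfig (Fin n) | ∀ s ∈ T, ∀ x ∈ (↑(R \ T) : Set (Fin n)), ¬ (openGraph ω).Reachable s x} ∩
            ⋃ s ∈ T, openConn s o) /
          (prodBernoulli w).real {ω : BondConfig (Fin n) | ∀ s ∈ T, ∀ x ∈ (↑(R \ T) : Set (Fin n)), ¬ (openGraph ω).Reachable s x}) *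
        ((prodBernoulli w).real ((⋂ a ∈ T, openConn a b) ∩ ⋂ a ∈ R \ T, (openConn a b)ᶜ : Set (BondConfig (Fin n)))
          - (prodBernoulli w).real ((⋂ a ∈ R \ T, openConn a b) ∩ ⋂ a ∈ T, (openConn a b)ᶜ : Set (BondConfig (Fin n)))) ≤
      (prodBernoulli w).real ((⋃ s ∈ T, openConn s o) ∩ ((⋂ a ∈ T, openConn a b) ∩ ⋂ a ∈ R \ T, (openConn a b)ᶜ))
        - (prodBernoulli w).real ((⋃ s ∈ T, openConn s o) ∩ ((⋂ a ∈ R \ T, openConn a b) ∩ ⋂ a ∈ T, (openConn a b)ᶜ)) := by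
  set D : Set (BondConfig (Fin n)) :=
    {ω : BondConfig (Fin n) | ∀ s ∈ T, ∀ x ∈ (↑(R \ T) : Set (Fin n)), ¬ (openGraph ω).Reachable s x} with hD
  set Eo : Set (BondConfig (Fin n)) := ⋃ s ∈ T, openConn s o with hEo
  set E : Set (BondConfig (Fin n)) := ((⋂ a ∈ T, openConn a b) ∩ ⋂ a ∈ R \ T, (openConn a b)ᶜ) with hE
  set E' : Set (BondConfig (Fin n)) := ((⋂ a ∈ R \ T, openConn a b) ∩ ⋂ a ∈ T, (openConn a b)ᶜ) with hE'
  have hTX : ∀ s ∈ T, s ∉ (↑(R \ T) : Set (Fin n)) := fun s hs h => by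
    rw [Finset.mem_coe, Finset.mem_sdiff] at h; exact h.2 hs
  -- (1) same-cluster BHK: `μ(D ∩ Eo) · m_T ≤ μ(D) · term_T`
  have i1 := knThm2_bhkOne stub_bhkSets.1 w T (↑(R \ T) : Set (Fin n)) o b hTX
  rw [← hD, knK_E_eq R T b hT, ← hE, show D ∩ (Eo ∩ ⋂ s ∈ T, openConn s b) = Eo ∩ E by
    rw [← Set.inter_assoc, Set.inter_comm D Eo, Set.inter_assoc, knK_E_eq R T b hT]] at i1
  -- (2) two-cluster BHK: `μ(D) · term'_T ≤ μ(D ∩ Eo) · m'_T`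
  have i2 := knThm2_bhkTwo stub_bhkSets.2 w T (R \ T) o b Finset.disjoint_sdiff
  have hDD : {ω : BondConfig (Fin n) | ∀ s ∈ T, ∀ x ∈ R \ T, ¬ (openGraph ω).Reachable s x} = D := rfl
  rw [show {ω : BondConfig (Fin n) | ∀ s ∈ T, ∀ x ∈ R \ T, ¬ (openGraph ω).Reachable s x} ∩ (Eo ∩ ⋂ s ∈ R \ T, openConn s b)
      = Eo ∩ E' by rw [← Set.inter_assoc, Set.inter_comm _ Eo, Set.inter_assoc, knK_E'_eq R T b hT'],
    knK_E'_eq R T b hT', ← hE', hDD] at i2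
  have hEsub : E ⊆ D := by
    intro ω hω; rw [hE, ← knK_E_eq R T b hT] at hω; exact hω.1
  have hE'sub : E' ⊆ D := by
    intro ω hω; rw [hE', ← knK_E'_eq R T b hT'] at hω; exact hω.1
  by_cases hD0 : (prodBernoulli w).real D = 0
  · have hmE : (prodBernoulli w).real E = 0 := le_antisymm (le_trans (measureReal_mono hEsub (measure_ne_top _ _)) hD0.le) measureReal_nonneg
    have hmE' : (prodBernoulli w).real E' = 0 := le_antisymm (le_trans (measureReal_mono hE'sub (measure_ne_top _ _)) hD0.le) measureReal_nonneg
    have ht : (prodBernoulli w).real (Eo ∩ E) = 0 :=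
      le_antisymm (le_trans (measureReal_mono Set.inter_subset_right (measure_ne_top _ _)) hmE.le) measureReal_nonneg
    have ht' : (prodBernoulli w).real (Eo ∩ E') = 0 :=
      le_antisymm (le_trans (measureReal_mono Set.inter_subset_right (measure_ne_top _ _)) hmE'.le) measureReal_nonneg
    simp only [hmE, hmE', ht, ht', sub_self, mul_zero, le_refl]
  have hDpos : 0 < (prodBernoulli w).real D := lt_of_le_of_ne measureReal_nonneg (Ne.symm hD0)
  -- `φ_T (m_T − m'_T) ≤ term_T − term'_T`
  have hphi : (prodBernoulli w).real (D ∩ Eo) / (prodBernoulli w).real D * ((prodBernoulli w).real E - (prodBernoulli w).real E') ≤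
      (prodBernoulli w).real (Eo ∩ E) - (prodBernoulli w).real (Eo ∩ E') := by
    rw [div_mul_eq_mul_div, div_le_iff₀ hDpos]
    nlinarith
  by_cases hle : (prodBernoulli w).real E' ≤ (prodBernoulli w).real E
  · rw [if_pos hle]
    have hMT : 0 < (prodBernoulli w).real {ω : BondConfig (Fin n) | ∀ k ∈ T, ∀ j ∈ R, k ≠ j → ¬ (openGraph ω).Reachable k j} :=
      lt_of_lt_of_le hM (measureReal_mono (fun ω hω k hk j hj hkj => hω k (hTR hk) j hj hkj) (measure_ne_top _ _))
    have L2 := knK_lemma2 w o R T hTR hMT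
    rw [← hD] at L2
    calc _ ≤ (prodBernoulli w).real (D ∩ Eo) / (prodBernoulli w).real D * ((prodBernoulli w).real E - (prodBernoulli w).real E') :=
          mul_le_mul_of_nonneg_right L2 (sub_nonneg.2 hle)
      _ ≤ _ := hphi
  · rw [if_neg hle]
    exact hphi

/-- The patterns `E_T`, `T ⊆ R`, are pairwise disjoint. [folklore] -/
theorem knK_E_disjoint (R : Finset (Fin n)) (b : Fin n) {T T' : Finset (Fin n)} (hT : T ⊆ R) (hT' : T' ⊆ R) (hne : T ≠ T') :
    Disjoint ((⋂ a ∈ T, openConn a b) ∩ ⋂ a ∈ R \ T, (openConn a b)ᶜ : Set (BondConfig (Fin n)))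
      ((⋂ a ∈ T', openConn a b) ∩ ⋂ a ∈ R \ T', (openConn a b)ᶜ) := by
  rw [Set.disjoint_left]
  intro ω h1 h2
  simp only [Set.mem_inter_iff, Set.mem_iInter, Set.mem_compl_iff, Finset.mem_sdiff] at h1 h2
  by_cases hsub : T ⊆ T'
  · have hns : ¬ T' ⊆ T := fun h => hne (Finset.Subset.antisymm hsub h)
    obtain ⟨a, haT', haT⟩ := Finset.not_subset.1 hns
    exact h1.2 a ⟨hT' haT', haT⟩ (h2.1 a haT')
  · obtain ⟨a, haT, haT'⟩ := Finset.not_subset.1 hsub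
    exact h2.2 a ⟨hT haT, haT'⟩ (h1.1 a haT)

/-- **Expansion of `μ(o↔R, o↔b, d↮b)` along the set of relays joined to `b`.** [cite: KozmaNitzan2024, Theorem 2 proof p. 8] -/
theorem knK_expand_left (w : Sym2 (Fin n) → unitInterval) (o b d : Fin n) (R : Finset (Fin n)) (hd : d ∈ R) :
    (prodBernoulli w).real (((⋃ a ∈ R, openConn o a) ∩ openConn o b) \ openConn d b) =
      ∑ T ∈ ((R.erase d).powerset).erase ∅,
        (prodBernoulli w).real ((⋃ s ∈ T, openConn s o) ∩ ((⋂ a ∈ T, openConn a b) ∩ ⋂ a ∈ R \ T, (openConn a b)ᶜ)) := by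
  rw [← measureReal_biUnion_finset (μ := prodBernoulli w)
    (fun T hT T' hT' hne => by
      rw [Finset.mem_coe, Finset.mem_erase, Finset.mem_powerset] at hT hT'
      exact Disjoint.mono Set.inter_subset_right Set.inter_subset_right
        (knK_E_disjoint R b (subset_trans hT.2 (Finset.erase_subset d R)) (subset_trans hT'.2 (Finset.erase_subset d R)) hne))
    (fun T _ => MeasurableSet.of_discrete)]
  congr 1
  ext ω
  simp only [Set.mem_sdiff, Set.mem_inter_iff, Set.mem_iUnion, Set.mem_iInter, Set.mem_compl_iff, exists_prop, Finset.mem_erase,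
    Finset.mem_powerset, Finset.mem_sdiff]
  constructor
  · rintro ⟨⟨⟨a, haR, hoa⟩, hob⟩, hdb⟩
    refine ⟨R.filter (fun a' => ω ∈ (openConn a' b : Set (BondConfig (Fin n)))), ⟨?_, ?_⟩, ⟨a, ?_, blockGrowth_openConn_symm hoa⟩, ?_, ?_⟩
    · intro h
      have : a ∈ R.filter (fun a' => ω ∈ (openConn a' b : Set (BondConfig (Fin n)))) :=
        Finset.mem_filter.2 ⟨haR, blockGrowth_openConn_trans (blockGrowth_openConn_symm hoa) hob⟩
      rw [h] at this; exact Finset.notMem_empty a this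
    · intro a' ha'
      rw [Finset.mem_filter] at ha'
      exact Finset.mem_erase.2 ⟨fun h => hdb (h ▸ ha'.2), ha'.1⟩
    · exact Finset.mem_filter.2 ⟨haR, blockGrowth_openConn_trans (blockGrowth_openConn_symm hoa) hob⟩
    · intro a' ha'; exact (Finset.mem_filter.1 ha').2
    · rintro a' ⟨ha'R, ha'⟩ h; exact ha' (Finset.mem_filter.2 ⟨ha'R, h⟩)
  · rintro ⟨T, ⟨hT0, hTR⟩, ⟨s, hs, hso⟩, hTb, hNb⟩
    have hsR : s ∈ R := Finset.mem_of_mem_erase (hTR hs)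
    refine ⟨⟨⟨s, hsR, blockGrowth_openConn_symm hso⟩, blockGrowth_openConn_trans (blockGrowth_openConn_symm hso) (hTb s hs)⟩, ?_⟩
    exact hNb d ⟨hd, fun h => Finset.notMem_erase d R (hTR h)⟩

/-- **Expansion of `μ(o↔R, d↔b, o↮b)` along the set of relays joined to `b` (complementary patterns).**
[cite: KozmaNitzan2024, Theorem 2 proof p. 8] -/
theorem knK_expand_right (w : Sym2 (Fin n) → unitInterval) (o b d : Fin n) (R : Finset (Fin n)) (hd : d ∈ R) :
    (prodBernoulli w).real (((⋃ a ∈ R, openConn o a) ∩ openConn d b) \ openConn o b) =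
      ∑ T ∈ ((R.erase d).powerset).erase ∅,
        (prodBernoulli w).real ((⋃ s ∈ T, openConn s o) ∩ ((⋂ a ∈ R \ T, openConn a b) ∩ ⋂ a ∈ T, (openConn a b)ᶜ)) := by
  rw [← measureReal_biUnion_finset (μ := prodBernoulli w)
    (fun T hT T' hT' hne => by
      rw [Finset.mem_coe, Finset.mem_erase, Finset.mem_powerset] at hT hT'
      refine Disjoint.mono Set.inter_subset_right Set.inter_subset_right (Set.disjoint_left.2 fun ω h1 h2 => ?_)
      simp only [Set.mem_inter_iff, Set.mem_iInter, Set.mem_compl_iff, Finset.mem_sdiff] at h1 h2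
      by_cases hsub : T ⊆ T'
      · have hns : ¬ T' ⊆ T := fun h => hne (Finset.Subset.antisymm hsub h)
        obtain ⟨a, haT', haT⟩ := Finset.not_subset.1 hns
        exact h2.2 a haT' (h1.1 a ⟨Finset.mem_of_mem_erase (hT'.2 haT'), haT⟩)
      · obtain ⟨a, haT, haT'⟩ := Finset.not_subset.1 hsub
        exact h1.2 a haT (h2.1 a ⟨Finset.mem_of_mem_erase (hT.2 haT), haT'⟩))
    (fun T _ => MeasurableSet.of_discrete)]
  congr 1
  ext ω
  simp only [Set.mem_sdiff, Set.mem_inter_iff, Set.mem_iUnion, Set.mem_iInter, Set.mem_compl_iff, exists_prop, Finset.mem_erase,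
    Finset.mem_powerset, Finset.mem_sdiff]
  constructor
  · rintro ⟨⟨⟨a, haR, hoa⟩, hdb⟩, hob⟩
    have hab : ω ∉ (openConn a b : Set (BondConfig (Fin n))) := fun h => hob (blockGrowth_openConn_trans hoa h)
    refine ⟨R.filter (fun a' => ω ∉ (openConn a' b : Set (BondConfig (Fin n)))), ⟨?_, ?_⟩, ⟨a, ?_, blockGrowth_openConn_symm hoa⟩, ?_, ?_⟩
    · intro h
      have : a ∈ R.filter (fun a' => ω ∉ (openConn a' b : Set (BondConfig (Fin n)))) := Finset.mem_filter.2 ⟨haR, hab⟩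
      rw [h] at this; exact Finset.notMem_empty a this
    · intro a' ha'
      rw [Finset.mem_filter] at ha'
      exact Finset.mem_erase.2 ⟨fun h => ha'.2 (h ▸ hdb), ha'.1⟩
    · exact Finset.mem_filter.2 ⟨haR, hab⟩
    · rintro a' ⟨ha'R, ha'⟩
      by_contra h
      exact ha' (Finset.mem_filter.2 ⟨ha'R, h⟩)
    · intro a' ha'; exact (Finset.mem_filter.1 ha').2
  · rintro ⟨T, ⟨hT0, hTR⟩, ⟨s, hs, hso⟩, hUb, hNb⟩
    have hsR : s ∈ R := Finset.mem_of_mem_erase (hTR hs)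
    refine ⟨⟨⟨s, hsR, blockGrowth_openConn_symm hso⟩, hUb d ⟨hd, fun h => Finset.notMem_erase d R (hTR h)⟩⟩, fun hob => ?_⟩
    exact hNb s hs (blockGrowth_openConn_trans hso hob)

/-- **Kozma–Nitzan's Theorem 2 exchange for `k` relays at an arbitrary designation.**  Relays `R ∋ d` (designation `d`), observer `o`,
target `b`; if all relays are simultaneously separable with positive probability and the certificate
`Σ_{∅ ≠ T ⊆ R∖d} c_T (m_T − m_{R∖T}) ≥ 0` holds (`c_T = Σ_{i∈T} φ_i` when `m_T ≥ m_{R∖T}`, else `φ_T`), then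
`μ((o ↔ R) ∩ (d ↔ b)) ≤ μ((o ↔ R) ∩ (o ↔ b))` (pre-FKG (3) at `d`).  For three relays and `m_d ≤ m_{R∖d}` this is Theorem 2 /
`knThm2_designated`.  [cite: KozmaNitzan2024, Theorem 2 (§3.1, pp. 8–9), Lemmas 1–2 pp. 5–6] -/
theorem knThmK_designated (w : Sym2 (Fin n) → unitInterval) (o b d : Fin n) (R : Finset (Fin n)) (hd : d ∈ R)
    (hM : 0 < (prodBernoulli w).real {ω : BondConfig (Fin n) | ∀ k ∈ R, ∀ j ∈ R, k ≠ j → ¬ (openGraph ω).Reachable k j})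
    (hcert : 0 ≤ ∑ T ∈ ((R.erase d).powerset).erase ∅,
      (if (prodBernoulli w).real ((⋂ a ∈ R \ T, openConn a b) ∩ ⋂ a ∈ T, (openConn a b)ᶜ : Set (BondConfig (Fin n)))
            ≤ (prodBernoulli w).real ((⋂ a ∈ T, openConn a b) ∩ ⋂ a ∈ R \ T, (openConn a b)ᶜ : Set (BondConfig (Fin n)))
          then ∑ i ∈ T, (prodBernoulli w).real ({ω : BondConfig (Fin n) | ∀ x ∈ R.erase i, ¬ (openGraph ω).Reachable i x} ∩ openConn i o) /
            (prodBernoulli w).real {ω : BondConfig (Fin n) | ∀ x ∈ R.erase i, ¬ (openGraph ω).Reachable i x}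
          else (prodBernoulli w).real ({ω : BondConfig (Fin n) | ∀ s ∈ T, ∀ x ∈ (↑(R \ T) : Set (Fin n)), ¬ (openGraph ω).Reachable s x} ∩
              ⋃ s ∈ T, openConn s o) /
            (prodBernoulli w).real {ω : BondConfig (Fin n) | ∀ s ∈ T, ∀ x ∈ (↑(R \ T) : Set (Fin n)), ¬ (openGraph ω).Reachable s x}) *
        ((prodBernoulli w).real ((⋂ a ∈ T, openConn a b) ∩ ⋂ a ∈ R \ T, (openConn a b)ᶜ : Set (BondConfig (Fin n)))
          - (prodBernoulli w).real ((⋂ a ∈ R \ T, openConn a b) ∩ ⋂ a ∈ T, (openConn a b)ᶜ : Set (BondConfig (Fin n))))) :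
    (prodBernoulli w).real ((⋃ a ∈ R, openConn o a) ∩ openConn d b) ≤
      (prodBernoulli w).real ((⋃ a ∈ R, openConn o a) ∩ openConn o b) := by
  have hsum := Finset.sum_le_sum (s := ((R.erase d).powerset).erase ∅) fun T hT => by
    rw [Finset.mem_erase, Finset.mem_powerset] at hT
    exact knK_perT w o b R T (subset_trans hT.2 (Finset.erase_subset d R)) (Finset.nonempty_iff_ne_empty.2 hT.1)
      ⟨d, Finset.mem_sdiff.2 ⟨hd, fun h => Finset.notMem_erase d R (hT.2 h)⟩⟩ hM
  have h0 := le_trans hcert hsum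
  rw [Finset.sum_sub_distrib, ← knK_expand_left w o b d R hd, ← knK_expand_right w o b d R hd] at h0
  have e1 := measureReal_inter_add_sdiff (μ := prodBernoulli w) (s := (⋃ a ∈ R, openConn o a) ∩ openConn d b)
    (MeasurableSet.of_discrete (s := (openConn o b : Set (BondConfig (Fin n)))))
  have e2 := measureReal_inter_add_sdiff (μ := prodBernoulli w) (s := (⋃ a ∈ R, openConn o a) ∩ openConn o b)
    (MeasurableSet.of_discrete (s := (openConn d b : Set (BondConfig (Fin n)))))
  have e3 : ((⋃ a ∈ R, openConn o a) ∩ openConn d b ∩ openConn o b : Set (BondConfig (Fin n))) =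
      (⋃ a ∈ R, openConn o a) ∩ openConn o b ∩ openConn d b := by
    rw [Set.inter_assoc, Set.inter_comm (openConn d b) (openConn o b), ← Set.inter_assoc]
  rw [e3] at e1
  linarith

/-- **Block form: the designated-pocket kernel from the `k`-relay certificate.**  In the glued weighting `u/S` with observer `s₀ ∈ S`,
relays `R ⊇ A∖b` with designation `a₀ ∈ R`: if all relays are simultaneously separable with positive probability and the `k`-relay
certificate of `knThmK_designated` (observer `s₀`) is `≥ 0`, then `μ_{u/S}((S ↔ A) ∩ (a₀ ↔ b)) ≤ μ_{u/S}(S ↔ b)`.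
[cite: KozmaNitzan2024, Theorem 2 (§3.1, pp. 8–9), Question 9 p. 36] -/
theorem dKernel_of_knThmK (u : Sym2 (Fin n) → unitInterval) (A S R : Finset (Fin n)) (s₀ b a₀ : Fin n)
    (hs₀ : s₀ ∈ S) (hAR : ∀ a ∈ A, a ≠ b → a ∈ R) (ha₀ : a₀ ∈ R)
    (hM : 0 < (prodBernoulli (fun e : Sym2 (Fin n) => if (∀ y ∈ e, y ∈ S) ∧ ¬ e.IsDiag then 1 else u e)).real
      {ω : BondConfig (Fin n) | ∀ k ∈ R, ∀ j ∈ R, k ≠ j → ¬ (openGraph ω).Reachable k j})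
    (hcert : 0 ≤ ∑ T ∈ ((R.erase a₀).powerset).erase ∅,
      (if (prodBernoulli (fun e : Sym2 (Fin n) => if (∀ y ∈ e, y ∈ S) ∧ ¬ e.IsDiag then 1 else u e)).real
              ((⋂ a ∈ R \ T, openConn a b) ∩ ⋂ a ∈ T, (openConn a b)ᶜ : Set (BondConfig (Fin n)))
            ≤ (prodBernoulli (fun e : Sym2 (Fin n) => if (∀ y ∈ e, y ∈ S) ∧ ¬ e.IsDiag then 1 else u e)).real
              ((⋂ a ∈ T, openConn a b) ∩ ⋂ a ∈ R \ T, (openConn a b)ᶜ : Set (BondConfig (Fin n)))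
          then ∑ i ∈ T, (prodBernoulli (fun e : Sym2 (Fin n) => if (∀ y ∈ e, y ∈ S) ∧ ¬ e.IsDiag then 1 else u e)).real
                ({ω : BondConfig (Fin n) | ∀ x ∈ R.erase i, ¬ (openGraph ω).Reachable i x} ∩ openConn i s₀) /
            (prodBernoulli (fun e : Sym2 (Fin n) => if (∀ y ∈ e, y ∈ S) ∧ ¬ e.IsDiag then 1 else u e)).real
                {ω : BondConfig (Fin n) | ∀ x ∈ R.erase i, ¬ (openGraph ω).Reachable i x}
          else (prodBernoulli (fun e : Sym2 (Fin n) => if (∀ y ∈ e, y ∈ S) ∧ ¬ e.IsDiag then 1 else u e)).real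
                ({ω : BondConfig (Fin n) | ∀ s ∈ T, ∀ x ∈ (↑(R \ T) : Set (Fin n)), ¬ (openGraph ω).Reachable s x} ∩ ⋃ s ∈ T, openConn s s₀) /
            (prodBernoulli (fun e : Sym2 (Fin n) => if (∀ y ∈ e, y ∈ S) ∧ ¬ e.IsDiag then 1 else u e)).real
                {ω : BondConfig (Fin n) | ∀ s ∈ T, ∀ x ∈ (↑(R \ T) : Set (Fin n)), ¬ (openGraph ω).Reachable s x}) *
        ((prodBernoulli (fun e : Sym2 (Fin n) => if (∀ y ∈ e, y ∈ S) ∧ ¬ e.IsDiag then 1 else u e)).real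
            ((⋂ a ∈ T, openConn a b) ∩ ⋂ a ∈ R \ T, (openConn a b)ᶜ : Set (BondConfig (Fin n)))
          - (prodBernoulli (fun e : Sym2 (Fin n) => if (∀ y ∈ e, y ∈ S) ∧ ¬ e.IsDiag then 1 else u e)).real
            ((⋂ a ∈ R \ T, openConn a b) ∩ ⋂ a ∈ T, (openConn a b)ᶜ : Set (BondConfig (Fin n))))) :
    (prodBernoulli (fun e : Sym2 (Fin n) => if (∀ y ∈ e, y ∈ S) ∧ ¬ e.IsDiag then 1 else u e)).real
        ((⋃ v ∈ S, ⋃ a ∈ A, openConn v a) ∩ openConn a₀ b)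
      ≤ (prodBernoulli (fun e : Sym2 (Fin n) => if (∀ y ∈ e, y ∈ S) ∧ ¬ e.IsDiag then 1 else u e)).real
        (⋃ v ∈ S, openConn v b) := by
  have hK := knThmK_designated (fun e : Sym2 (Fin n) => if (∀ y ∈ e, y ∈ S) ∧ ¬ e.IsDiag then 1 else u e) s₀ b a₀ R ha₀ hM hcert
  -- union form ≤ single-observer form (a.s. under the glued weighting)
  have hL : (prodBernoulli (fun e : Sym2 (Fin n) => if (∀ y ∈ e, y ∈ S) ∧ ¬ e.IsDiag then 1 else u e)).real
        ((⋃ v ∈ S, ⋃ a ∈ A, openConn v a) ∩ openConn a₀ b)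
      ≤ (prodBernoulli (fun e : Sym2 (Fin n) => if (∀ y ∈ e, y ∈ S) ∧ ¬ e.IsDiag then 1 else u e)).real
        ((⋃ a ∈ R, openConn s₀ a) ∩ openConn a₀ b) := by
    refine dthree_real_le_of_allOpen u S _ _ fun ω hKo hω => ?_
    obtain ⟨hU, hab⟩ := hω
    refine ⟨?_, hab⟩
    simp only [Set.mem_iUnion, exists_prop] at hU ⊢
    obtain ⟨v, hv, a, ha, hva⟩ := hU
    have hsv : ω ∈ (openConn s₀ v : Set (BondConfig (Fin n))) := dthree_openConn_of_allOpen S ω hKo hv hs₀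
    have hsa : ω ∈ (openConn s₀ a : Set (BondConfig (Fin n))) := blockGrowth_openConn_trans hsv hva
    by_cases hab' : a = b
    · subst hab'
      exact ⟨a₀, ha₀, blockGrowth_openConn_trans hsa (blockGrowth_openConn_symm hab)⟩
    · exact ⟨a, hAR a ha hab', hsa⟩
  have hR : (prodBernoulli (fun e : Sym2 (Fin n) => if (∀ y ∈ e, y ∈ S) ∧ ¬ e.IsDiag then 1 else u e)).real
        ((⋃ a ∈ R, openConn s₀ a) ∩ openConn s₀ b)
      ≤ (prodBernoulli (fun e : Sym2 (Fin n) => if (∀ y ∈ e, y ∈ S) ∧ ¬ e.IsDiag then 1 else u e)).real (⋃ v ∈ S, openConn v b) :=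
    measureReal_mono (fun ω hω => Set.mem_iUnion₂.2 ⟨s₀, hs₀, hω.2⟩) (measure_ne_top _ _)
  linarith

end KnThmK

end

end Summit.CriticalPhenomena.PercolationContinuityZ3.Theorems
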